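import Summits.ABC.ABC.Theses.RootDecompG
import HarnessLib

/-!
# Route RootDecompG — `Assembly` (item stmt-ABC-27126)

`KummerFloor4 → KummerFloorCell4 → ABC` (`Summit.ABC.ABC.Theses.RootDecompG.Assembly`), proved
unconditionally: the two route cruxes are its hypotheses, nothing else is assumed.  The floor puts
every abc triple in the cell `K := C₀`; the cell piece is abc there.

The proof is the body of the route's deciding theorem `RootDecompG.closes` copied VERBATIM rather than
a citation of `closes`, so that this file keeps compiling under any later re-glue of the route
(cell decomp-abc, writer LANDING LIST; D-0178 root decomposition, door G).  Bookkeeping only: nothing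
here proves `ABC` or decides the declared residual `LopKummerCell4`.
-/

set_option linter.dupNamespace false

namespace Summit.ABC.ABC.Theorems

/-- Item stmt-ABC-27126, literally the route decl `RootDecompG.Assembly`
(`KummerFloor4 → KummerFloorCell4 → ABC`). -/
theorem rootDecompG_assembly_proof : Summit.ABC.ABC.Theses.RootDecompG.Assembly := by
  unfold Summit.ABC.ABC.Theses.RootDecompG.Assembly
  intro hF hC
  rw [_root_.ABC_iff]
  intro ε hε
  obtain ⟨C₀, hF⟩ := hF
  obtain ⟨C, hC0, hb⟩ := hC C₀ ε hε
  exact ⟨C, hC0, fun a b c ht => hb a b c ht (hF a b c ht)⟩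

end Summit.ABC.ABC.Theorems
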